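import Literature.MathematicalPhysics.QuantumLattice.HubbardTTPrimeOpenBoxGrandCanonicalPressureExact
import Literature.MathematicalPhysics.QuantumLattice.HubbardTTPrimeThermalStatesEntropyDensityCanonical
import Literature.MathematicalPhysics.QuantumLattice.HubbardTTPrimeGrandCanonicalThermalStatesExistence
import Literature.MathematicalPhysics.QuantumLattice.HubbardTTPrimeGrandCanonicalThermalStatesKMSRows
import HarnessLib

/-!
# Canonical thermal states of the 2D `t–t'` Hubbard model are grand-canonical VARIATIONAL EQUILIBRIUM states;
# the free-boundary pressure equals the periodic one; charged KMS rows for the canonical class modulo Araki–Moriya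

Topic `Literature/MathematicalPhysics/QuantumLattice` (family `hubbard`). The thermal object of record of the `T > 0`
certificate family (cell `hubbard-thermal`) is the CANONICAL class: torus limits `ω` of the `(rectN n L, S^z = 0)`-sector
Gibbs states of `hubbardTorusTT' L t t' U` at `β > 0`,
`ω.IsTorusLimitOfMixture (sectorGibbsCount n) (sectorGibbsWeightTT' β t t' U n ·) (sectorGibbsVectorTT' t t' U n ·) Ls`.
Its certified rows are the gauge-invariant (particle-number conserving) ones; the CHARGED rows (`c_{xσ}`, pair fields, …)
of `HubbardTTPrimeGrandCanonicalThermalStatesKMSRows` are proved for the grand-canonical class only («charged rows would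
need BR II 5.3.15 — not in tree», the cell's CERT-THERMAL). This file and its companion
`HubbardTTPrimeCanonicalStatesChargedRows` close the gap up to ONE published theorem (the companion carries §3–§4):

* §1 **THE FREE-BOUNDARY GRAND-CANONICAL PRESSURE EQUALS THE PERIODIC ONE, WITH A RATE** (`β ≥ 0`, `U ≥ 0`, `ℓ ≥ 1`):
  `ℓ²·P − β(8|t|+16|t'|)ℓ ≤ log Re Ξ^open_ℓ(β; t,t',U; μ,h) ≤ ℓ²·P` (`sq_mul_gcPressure_sub_le_log_partitionFn_openBox_gc`,
  with the exact cluster floor of `HubbardTTPrimeOpenBoxGrandCanonicalPressureExact` as the upper half; the lower half is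
  Gibbs' variational inequality on the box for the restriction of a thermal grand-canonical state, whose box entropy is
  `≥ ℓ²(P + βu)` and whose box energy is `≤ ℓ²u + (8|t|+16|t'|)ℓ`), hence
  `|ℓ⁻² log Re Ξ^open_ℓ − P| ≤ β(8|t|+16|t'|)/ℓ` and **`tendsto_log_partitionFn_openBox_gc_div_sq`: `ℓ⁻² log Re Ξ^open_ℓ → P`**
  — Araki–Moriya's pressure (free boundary conditions, van Hove boxes) IS the tree's `gcPressureTT'Zeeman`.
* §2 **CANONICAL THERMAL STATES ARE GRAND-CANONICAL VARIATIONAL EQUILIBRIUM STATES** at every supporting chemical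
  potential `μ₀` of `p(β;·)` at `n` (`p(n) = P(μ₀) − βμ₀n`, `HubbardTTPrimeGrandCanonicalEnsembleEquivalence`):
  `S(ω_{[0,ℓ)²})/ℓ² → P(β; t,t',U; μ₀, 0) + β·u_{μ₀}(ω)` (`…tendsto_vonNeumannEntropy_rdm_div_sq_gc_of_sectorGibbs`), i.e. `ω`
  solves Araki–Moriya's variational principle `P = s(ω) − β e_Φ(ω)` for the grand-canonical interaction at `(μ₀, h = 0)`;
  and the MASTER INEQUALITY (the joint temperature × coupling × `μ` × `h` tangent plane for canonical states): for all
  `β₁ ≥ 0`, `t₁, t'₁`, `U₁ ≥ 0`, `μ₁, h₁`,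
  **`p(β;t,t',U;n) + β e_Φ(ω) ≤ P(β₁;t₁,t'₁,U₁;μ₁,h₁) + β₁ u_{x₁}(ω)`** (`…pressureTT'_add_le_gcPressureTT'Zeeman_add_of_sectorGibbs`),
  `u_{x₁}(ω) = e_{Φ(t₁,t'₁,U₁)}(ω) − μ₁ρ(ω) − h₁m(ω)` — every Griffiths / Bogoliubov bracket of the grand-canonical numbers
  applies to the canonical state.
* §3 NAMED FACT (statement only, not proved here): `localDKMSOfVariationalPrincipleTTPrime` — Araki–Moriya, Rev. Math.
  Phys. 15 (2003) 93, **Theorem 12.11** (a translation-invariant solution of the `(Φ, β)`-variational principle is a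
  `(δ_Φ, β)`-dKMS state on the strictly local algebra; Definition 6.3 (C-1), (C-2); Theorem 5.13 `δ_Φ A = i[H_I, A]`),
  transcribed for the standard potential of the grand-canonical `t–t'` Hubbard interaction in the tree's vocabulary
  (§1 identifies the pressures; the singleton terms differ from the standard potential by the constant `U/4 − μ`, which
  drops out of both the variational equation and the derivation; (C-2) is written as its equivalent family of tangent
  lines `y log(y/x) = sup {sy − qx : e^{s−1} ≤ q}`, the row shape of `…ThermalStatesKMSRows`).
* §4 CONSEQUENCES MODULO THE NAMED FACT: stationarity from (C-1) by polarisation (`expect_commutator_eq_zero_of_localDKMS`,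
  proved), and **for every canonical thermal torus-limit state at `(β; t,t',U; n)`, `0 < n < 2`, and every supporting `μ₀`:
  the stationarity rows `ω(K_{Λ'}Ã − ÃK_{Λ'}) = 0` and the energy–entropy balance rows
  `0 ≤ Re ω(β Ãᴴ[K_{Λ'},Ã] − s ÃᴴÃ + q ÃÃᴴ)` (`e^{s−1} ≤ q`) hold for EVERY local `A` — charged included — with
  `K_{Λ'} = gcLocalHamiltonianTT' Λ' t t' U μ₀ 0`** (`…of_sectorGibbs_of_localDKMS`). The supporting `μ₀` is bracketed by the
  certified `μ`-band of `n` (`HubbardTTPrimeThermalPressureChemicalPotentialBand`), so the rows enter a canonical relaxation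
  with `μ₀` as one bounded scalar unknown (the rows are affine in `μ₀`).

Everything in this file (§1, §2 and the polarisation lemma `expect_commutator_eq_zero_of_localDKMS` of §4) is PROVED; no
definition, no named fact, no number. The named fact (§3) and the conditional rows (§4) are in the companion file.

## Mathlib / tree search

REUSED: `log_partitionFn_openBox_gc_le_sq_mul_gcPressure`, `log_partitionFn_gcLocalHamiltonianTT'_halfOpenBox_le_sq_mul`
(`…OpenBoxGrandCanonicalPressureExact`); `partitionFn_gcLocalHamiltonianTT'_halfOpenBox`, `gcLocalHamiltonianTT'_isHermitian`
(`…OpenBoxGrandCanonicalPressureBound`); `exists_isTorusLimitOfMixture_gcGibbs_translationInvariant` (`…ThermalStatesExistence`);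
`IsTorusLimitOfMixture.sq_mul_le_vonNeumannEntropy_rdm_halfOpenBox_of_gcGibbs`, `IsTranslationInvariant.vonNeumannEntropy_rdm_halfOpenBox_le`,
`…re_expect_gcLocalHamiltonianTT'_halfOpenBox_le` (`…ThermalStatesEntropyDensity`); `IsHermitian.vonNeumannEntropy_sub_mul_le_log_partitionFn`,
`trace_rdm_mul`; `IsTorusLimitOfMixture.tendsto_vonNeumannEntropy_rdm_div_sq_of_sectorGibbs`,
`…sq_mul_le_vonNeumannEntropy_rdm_halfOpenBox_of_sectorGibbs` (`…EntropyDensityCanonical`); `exists_chemicalPotential_pressureTT'_eq`;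
`gcPressureTT'Zeeman_zero`; `IsTorusLimitOfMixture.density_eq_of_sectorGibbs`, `….isTranslationInvariant`; the row shapes of
`IsTorusLimitOfMixture.re_expect_eeb_nonneg_of_gcGibbs` / `…expect_commutator_gcLocalHamiltonianTT'_eq_zero_of_gcGibbs`
(`…ThermalStatesKMSRows`). `lean search 'dKMS|variational.*KMS|openBox.*tendsto.*gcPressure'` (2026-08-27): nothing.

## References

* H. Araki, H. Moriya, *Equilibrium statistical mechanics of fermion lattice systems*, Rev. Math. Phys. 15 (2003) 93–198,
  Theorem 12.11 (variational principle ⇒ dKMS on `𝔄_loc`), Definition 6.3 (dKMS: (C-1), (C-2)), Theorem 5.13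
  (`δ_Φ A = i[H_I, A]`), Theorem A/B (KMS ⇔ variational principle). [cite: ArakiMoriya2003, Theorem 12.11]
* O. Bratteli, D. W. Robinson, *Operator Algebras and Quantum Statistical Mechanics 2* (1997), Thm. 5.3.15 (the
  Roepstorff–Araki–Sewell auto-correlation bounds ⇔ KMS). [cite: BratteliRobinsonII1997, Thm. 5.3.15]
* R. B. Israel, *Convexity in the Theory of Lattice Gases* (1979), Lemma II.3.1, Thm. I.2.4 (boundary conditions; tangent
  functionals). [cite: Israel1979, Lemma II.3.1]
* H. Fawzi, O. Fawzi, S. O. Scalet, *Certified algorithms for equilibrium states of local quantum Hamiltonians*,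
  Nat. Commun. 15 (2024) 7394, Thm. 3.1 (the row family). [cite: FawziFawziScalet2024, Thm. 3.1]
-/

noncomputable section

open scoped ComplexOrder BigOperators
open Finset Literature.InformationTheory.Entropy

namespace Literature.MathematicalPhysics.QuantumLattice

open Matrix HubbardWave0 Literature.Probability.LatticeModels ThermodynamicLimit
open _root_.Filter
open scoped _root_.Topology

/-! ### §1 The free-boundary grand-canonical pressure equals the periodic one -/

section FreeBoundary

variable {β : ℝ} (hβ : 0 ≤ β) (t t' : ℝ) {U : ℝ} (hU : 0 ≤ U) (μ hz : ℝ)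
include hβ hU

/-- **Lower half, local-Hamiltonian form**: `ℓ²·P − β(8|t|+16|t'|)ℓ ≤ log Re Tr e^{−βK_{[0,ℓ)²}}` (`ℓ ≥ 1`). Gibbs'
variational inequality on the box for the restriction of a thermal grand-canonical torus-limit state (which exists,
`…ThermalStatesExistence`): its box entropy is `≥ ℓ²(P + βu)` and its box energy is `≤ ℓ²u + (8|t|+16|t'|)ℓ`.
[cite: Israel1979, Lemma II.3.1] [cite: ArakiMoriya2003, Theorem 12.11] -/
theorem sq_mul_gcPressure_sub_le_log_partitionFn_gcLocalHamiltonianTT' {ℓ : ℕ} (hℓ : 1 ≤ ℓ) :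
    (ℓ : ℝ) ^ 2 * gcPressureTT'Zeeman β t t' U μ hz - β * ((8 * |t| + 16 * |t'|) * ℓ) ≤
      Real.log (partitionFn β (gcLocalHamiltonianTT' (halfOpenBox 2 ℓ) t t' U μ hz)).re := by
  obtain ⟨Ls, ω, hLs, hω, hTI⟩ := InfVolFermionState.exists_isTorusLimitOfMixture_gcGibbs_translationInvariant β t t' U μ hz
  set B := halfOpenBox 2 ℓ with hB
  set K := gcLocalHamiltonianTT' B t t' U μ hz with hK
  have hGibbs := (gcLocalHamiltonianTT'_isHermitian B t t' U μ hz).vonNeumannEntropy_sub_mul_le_log_partitionFn β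
    (ω.rdm_posSemidef B) (ω.trace_rdm B)
  rw [InfVolFermionState.trace_rdm_mul] at hGibbs
  have hS := hω.sq_mul_le_vonNeumannEntropy_rdm_halfOpenBox_of_gcGibbs hβ t t' hU μ hz hLs hℓ
  have hE := hTI.re_expect_gcLocalHamiltonianTT'_halfOpenBox_le t t' U μ hz ℓ
  have hβE := mul_le_mul_of_nonneg_left hE hβ
  rw [← hK] at hGibbs hβE
  linarith [hGibbs, hS, hβE]

/-- **Lower half, open-box form**: `ℓ²·P − β(8|t|+16|t'|)ℓ ≤ log Re Tr e^{−β(H^open_ℓ − μN − hM)}` (`ℓ ≥ 1`).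
[cite: Israel1979, Lemma II.3.1] -/
theorem sq_mul_gcPressure_sub_le_log_partitionFn_openBox_gc {ℓ : ℕ} (hℓ : 1 ≤ ℓ) :
    (ℓ : ℝ) ^ 2 * gcPressureTT'Zeeman β t t' U μ hz - β * ((8 * |t| + 16 * |t'|) * ℓ) ≤
      Real.log (partitionFn β (hubbardOpenBoxTT' ℓ ℓ t t' U - (μ : ℂ) • totalNumber - (hz : ℂ) • spinImbalance)).re := by
  rw [← partitionFn_gcLocalHamiltonianTT'_halfOpenBox]
  exact sq_mul_gcPressure_sub_le_log_partitionFn_gcLocalHamiltonianTT' hβ t t' hU μ hz hℓ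

/-- **TWO-SIDED, EVERY `ℓ`**: `|ℓ⁻² log Re Ξ^open_ℓ − P| ≤ β(8|t|+16|t'|)/ℓ` — the open-box (free-boundary) grand-canonical
pressure per site is within `β(8|t|+16|t'|)/ℓ` of (and never above) the thermodynamic pressure.
[cite: Israel1979, Lemma II.3.1] -/
theorem abs_log_partitionFn_openBox_gc_div_sq_sub_gcPressure_le {ℓ : ℕ} (hℓ : 1 ≤ ℓ) :
    |Real.log (partitionFn β (hubbardOpenBoxTT' ℓ ℓ t t' U - (μ : ℂ) • totalNumber - (hz : ℂ) • spinImbalance)).re /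
        (ℓ : ℝ) ^ 2 - gcPressureTT'Zeeman β t t' U μ hz| ≤ β * (8 * |t| + 16 * |t'|) / ℓ := by
  have hup := log_partitionFn_openBox_gc_le_sq_mul_gcPressure hβ t t' hU μ hz hℓ
  have hlo := sq_mul_gcPressure_sub_le_log_partitionFn_openBox_gc hβ t t' hU μ hz hℓ
  have hℓpos : (0 : ℝ) < ℓ := by exact_mod_cast hℓ
  have hℓ2 : (0 : ℝ) < (ℓ : ℝ) ^ 2 := by positivity
  set z := Real.log (partitionFn β (hubbardOpenBoxTT' ℓ ℓ t t' U - (μ : ℂ) • totalNumber -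
    (hz : ℂ) • spinImbalance)).re with hz_def
  rw [abs_le]
  constructor
  · -- `−c/ℓ ≤ z/ℓ² − P`
    have h1 : gcPressureTT'Zeeman β t t' U μ hz - β * (8 * |t| + 16 * |t'|) / ℓ ≤ z / (ℓ : ℝ) ^ 2 := by
      rw [le_div_iff₀ hℓ2]
      have e : (gcPressureTT'Zeeman β t t' U μ hz - β * (8 * |t| + 16 * |t'|) / ℓ) * (ℓ : ℝ) ^ 2 =
          (ℓ : ℝ) ^ 2 * gcPressureTT'Zeeman β t t' U μ hz - β * ((8 * |t| + 16 * |t'|) * ℓ) := by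
        field_simp
      rw [e]
      exact hlo
    linarith
  · have h2 : z / (ℓ : ℝ) ^ 2 ≤ gcPressureTT'Zeeman β t t' U μ hz := by
      rw [div_le_iff₀ hℓ2]; linarith
    have h3 : 0 ≤ β * (8 * |t| + 16 * |t'|) / ℓ := by positivity
    linarith

/-- **THE FREE-BOUNDARY GRAND-CANONICAL PRESSURE EXISTS AND EQUALS THE PERIODIC ONE**:
`ℓ⁻² log Re Tr e^{−β(H^open_ℓ − μN − hM)} → P(β; t,t',U; μ,h)` (`β ≥ 0`, `U ≥ 0`) — Araki–Moriya's / Israel's pressure (van Hove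
boxes, free boundary conditions) is the tree's torus pressure `gcPressureTT'Zeeman`.
[cite: Israel1979, Lemma II.3.1] [cite: ArakiMoriya2003, Theorem 12.11] -/
theorem tendsto_log_partitionFn_openBox_gc_div_sq :
    Tendsto (fun ℓ : ℕ => Real.log (partitionFn β (hubbardOpenBoxTT' ℓ ℓ t t' U - (μ : ℂ) • totalNumber -
      (hz : ℂ) • spinImbalance)).re / (ℓ : ℝ) ^ 2) atTop (𝓝 (gcPressureTT'Zeeman β t t' U μ hz)) := by
  set P := gcPressureTT'Zeeman β t t' U μ hz with hP
  set c : ℝ := β * (8 * |t| + 16 * |t'|) with hc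
  have hinv : Tendsto (fun ℓ : ℕ => (ℓ : ℝ)⁻¹) atTop (𝓝 0) := tendsto_inv_atTop_nhds_zero_nat (𝕜 := ℝ)
  have hlower : Tendsto (fun ℓ : ℕ => P - c / ℓ) atTop (𝓝 P) := by
    have h := (hinv.const_mul c).const_sub P
    rw [mul_zero, sub_zero] at h
    refine h.congr fun ℓ => ?_
    rw [div_eq_mul_inv]
  refine tendsto_of_tendsto_of_tendsto_of_le_of_le' hlower tendsto_const_nhds ?_ ?_
  · filter_upwards [eventually_ge_atTop 1] with ℓ hℓ
    have h := abs_log_partitionFn_openBox_gc_div_sq_sub_gcPressure_le hβ t t' hU μ hz hℓ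
    rw [hc]
    linarith [(abs_le.1 h).1]
  · filter_upwards [eventually_ge_atTop 1] with ℓ hℓ
    exact log_partitionFn_openBox_gc_div_sq_le_gcPressure hβ t t' hU μ hz hℓ

/-- The same limit for the local grand-canonical Hamiltonians of the boxes `[0,ℓ)² ⊂ ℤ²`. [cite: Israel1979, Lemma II.3.1] -/
theorem tendsto_log_partitionFn_gcLocalHamiltonianTT'_halfOpenBox_div_sq :
    Tendsto (fun ℓ : ℕ => Real.log (partitionFn β (gcLocalHamiltonianTT' (halfOpenBox 2 ℓ) t t' U μ hz)).re / (ℓ : ℝ) ^ 2)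
      atTop (𝓝 (gcPressureTT'Zeeman β t t' U μ hz)) := by
  refine (tendsto_log_partitionFn_openBox_gc_div_sq hβ t t' hU μ hz).congr fun ℓ => ?_
  rw [partitionFn_gcLocalHamiltonianTT'_halfOpenBox]

end FreeBoundary

/-- The error budget `(β(8|t|+16|t'|)ℓ + 2 log(ℓ²+1))/ℓ² ≤ (β(8|t|+16|t'|) + 4)/ℓ` (`ℓ ≥ 1`, `β ≥ 0`). [folklore] -/
private theorem err_div_sq_le_g10 {β : ℝ} (hβ : 0 ≤ β) (t t' : ℝ) (ℓ : ℕ) (hℓ : 1 ≤ ℓ) :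
    (β * ((8 * |t| + 16 * |t'|) * ℓ) + 2 * Real.log ((ℓ : ℝ) ^ 2 + 1)) / (ℓ : ℝ) ^ 2 ≤
      (β * (8 * |t| + 16 * |t'|) + 4) / ℓ := by
  have hℓ' : (1 : ℝ) ≤ ℓ := by exact_mod_cast hℓ
  have hℓpos : (0 : ℝ) < ℓ := by linarith
  have hlog : Real.log ((ℓ : ℝ) ^ 2 + 1) ≤ 2 * ℓ := by
    have h1 : (ℓ : ℝ) ^ 2 + 1 ≤ ((ℓ : ℝ) + 1) ^ 2 := by nlinarith
    have h2 : Real.log ((ℓ : ℝ) ^ 2 + 1) ≤ Real.log (((ℓ : ℝ) + 1) ^ 2) := Real.log_le_log (by positivity) h1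
    have h3 : Real.log (((ℓ : ℝ) + 1) ^ 2) = 2 * Real.log ((ℓ : ℝ) + 1) := by
      rw [Real.log_pow]; push_cast; ring
    have h4 : Real.log ((ℓ : ℝ) + 1) ≤ (ℓ : ℝ) + 1 - 1 := Real.log_le_sub_one_of_pos (by positivity)
    linarith
  have hK : 0 ≤ β * (8 * |t| + 16 * |t'|) := by positivity
  rw [div_le_div_iff₀ (by positivity) hℓpos]
  have e1 : (β * (8 * |t| + 16 * |t'|) + 4) * (ℓ : ℝ) ^ 2 = (β * ((8 * |t| + 16 * |t'|) * ℓ) + 4 * ℓ) * ℓ := by ring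
  rw [e1]
  exact mul_le_mul_of_nonneg_right (by linarith) hℓpos.le

namespace InfVolFermionState

/-! ### §2 Canonical thermal states are grand-canonical variational equilibrium states -/

section Canonical

variable (t t' : ℝ) {U : ℝ} (hU : 0 ≤ U) {β : ℝ} (hβ : 0 < β) {ω : InfVolFermionState 2} {Ls : ℕ → ℕ} {n : ℝ}
include hU hβ

/-- **A canonical thermal state solves the GRAND-CANONICAL variational principle at every supporting chemical potential.**
If `ω` is a canonical thermal torus-limit state at `(β; t,t',U; n)`, `0 < n < 2`, and `μ₀` supports `p(β;·)` at `n`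
(`p(n) = P(μ₀) − βμ₀n`), then `S(ω_{[0,ℓ)²})/ℓ² → P(β; t,t',U; μ₀, 0) + β·(e_Φ(ω) − μ₀ρ(ω) − 0·m(ω))`: the entropy density of
`ω` attains the grand-canonical variational bound at `(μ₀, h = 0)`. [cite: ArakiMoriya2003, Theorem 12.11] [cite: Israel1979, Thm. I.2.4] -/
theorem IsTorusLimitOfMixture.tendsto_vonNeumannEntropy_rdm_div_sq_gc_of_sectorGibbs (hn0 : 0 < n) (hn2 : n < 2)
    (h : ω.IsTorusLimitOfMixture (sectorGibbsCount n) (fun L => sectorGibbsWeightTT' β t t' U n L)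
      (fun L => sectorGibbsVectorTT' t t' U n L) Ls)
    (hLs : Tendsto Ls atTop atTop) {μ₀ : ℝ} (hμ₀ : pressureTT' β t t' U n = gcPressureTT' β t t' U μ₀ - β * μ₀ * n) :
    Tendsto (fun ℓ : ℕ => vonNeumannEntropy (ω.rdm (halfOpenBox 2 ℓ)) / (ℓ : ℝ) ^ 2) atTop
      (𝓝 (gcPressureTT'Zeeman β t t' U μ₀ 0 +
        β * (ω.meanEnergy (hubbardTTPrimeFermionInteraction t t' U) 1 - μ₀ * ω.density -
          0 * ((ω.expect ({0} : Finset (Site 2)) (nAt 0 (mem_singleton_self 0) 0)).re -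
            (ω.expect ({0} : Finset (Site 2)) (nAt 0 (mem_singleton_self 0) 1)).re)))) := by
  have hlim := h.tendsto_vonNeumannEntropy_rdm_div_sq_of_sectorGibbs t t' hU hβ hn0 hn2 hLs
  have hρ : ω.density = n := h.density_eq_of_sectorGibbs t t' U hn0.le hn2.le β hLs
  have e : gcPressureTT'Zeeman β t t' U μ₀ 0 +
        β * (ω.meanEnergy (hubbardTTPrimeFermionInteraction t t' U) 1 - μ₀ * ω.density -
          0 * ((ω.expect ({0} : Finset (Site 2)) (nAt 0 (mem_singleton_self 0) 0)).re -
            (ω.expect ({0} : Finset (Site 2)) (nAt 0 (mem_singleton_self 0) 1)).re)) =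
      pressureTT' β t t' U n + β * ω.meanEnergy (hubbardTTPrimeFermionInteraction t t' U) 1 := by
    rw [gcPressureTT'Zeeman_zero, hμ₀, hρ]; ring
  rw [e]
  exact hlim

/-- **THE MASTER INEQUALITY (joint tangent plane for canonical thermal states).** If `ω` is a canonical thermal
torus-limit state at `(β; t,t',U; n)`, `0 < n < 2`, then for all `β₁ ≥ 0`, `t₁, t'₁`, `U₁ ≥ 0`, `μ₁`, `h₁`:
`p(β;t,t',U;n) + β·e_Φ(ω) ≤ P(β₁; t₁,t'₁,U₁; μ₁,h₁) + β₁·(e_{Φ(t₁,t'₁,U₁)}(ω) − μ₁ρ(ω) − h₁m(ω))`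
— the entropy density of `ω` (left side) never exceeds the grand-canonical variational bound at any other parameter point.
Every Griffiths/Bogoliubov bracket for canonical states (in `β`, `t'`, `U`, `μ`, `h`) is a specialisation.
[cite: Israel1979, Thm. I.2.4] [cite: ArakiMoriya2003, Theorem 12.11] -/
theorem IsTorusLimitOfMixture.pressureTT'_add_le_gcPressureTT'Zeeman_add_of_sectorGibbs (hn0 : 0 < n) (hn2 : n < 2)
    (h : ω.IsTorusLimitOfMixture (sectorGibbsCount n) (fun L => sectorGibbsWeightTT' β t t' U n L)
      (fun L => sectorGibbsVectorTT' t t' U n L) Ls)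
    (hLs : Tendsto Ls atTop atTop) {β₁ : ℝ} (hβ₁ : 0 ≤ β₁) (t₁ t'₁ : ℝ) {U₁ : ℝ} (hU₁ : 0 ≤ U₁) (μ₁ h₁ : ℝ) :
    pressureTT' β t t' U n + β * ω.meanEnergy (hubbardTTPrimeFermionInteraction t t' U) 1 ≤
      gcPressureTT'Zeeman β₁ t₁ t'₁ U₁ μ₁ h₁ +
        β₁ * (ω.meanEnergy (hubbardTTPrimeFermionInteraction t₁ t'₁ U₁) 1 - μ₁ * ω.density -
          h₁ * ((ω.expect ({0} : Finset (Site 2)) (nAt 0 (mem_singleton_self 0) 0)).re -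
            (ω.expect ({0} : Finset (Site 2)) (nAt 0 (mem_singleton_self 0) 1)).re)) := by
  have hTI := h.isTranslationInvariant
  set L : ℝ := pressureTT' β t t' U n + β * ω.meanEnergy (hubbardTTPrimeFermionInteraction t t' U) 1 with hLdef
  set R : ℝ := gcPressureTT'Zeeman β₁ t₁ t'₁ U₁ μ₁ h₁ +
        β₁ * (ω.meanEnergy (hubbardTTPrimeFermionInteraction t₁ t'₁ U₁) 1 - μ₁ * ω.density -
          h₁ * ((ω.expect ({0} : Finset (Site 2)) (nAt 0 (mem_singleton_self 0) 0)).re -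
            (ω.expect ({0} : Finset (Site 2)) (nAt 0 (mem_singleton_self 0) 1)).re)) with hRdef
  set C : ℝ := β₁ * (8 * |t₁| + 16 * |t'₁|) + 4 with hC
  have hCpos : 0 < C := by
    have : 0 ≤ β₁ * (8 * |t₁| + 16 * |t'₁|) := by positivity
    linarith
  refine le_of_forall_pos_le_add fun ε hε => ?_
  obtain ⟨N, hN⟩ := exists_nat_gt (C / ε)
  set ℓ : ℕ := max N 1 with hℓdef
  have hℓ1 : 1 ≤ ℓ := le_max_right _ _
  have hℓN : (N : ℝ) ≤ ℓ := by exact_mod_cast le_max_left N 1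
  have hℓpos : (0 : ℝ) < ℓ := by exact_mod_cast hℓ1
  have hℓ2 : (0 : ℝ) < (ℓ : ℝ) ^ 2 := by positivity
  have hlow := h.sq_mul_le_vonNeumannEntropy_rdm_halfOpenBox_of_sectorGibbs t t' hU hβ hn0.le hn2 hLs hℓ1
  have hup := hTI.vonNeumannEntropy_rdm_halfOpenBox_le hβ₁ t₁ t'₁ hU₁ μ₁ h₁ hℓ1
  rw [← hLdef] at hlow
  rw [← hRdef] at hup
  have herr := err_div_sq_le_g10 hβ₁ t₁ t'₁ ℓ hℓ1
  have hCℓ : C / ℓ ≤ ε := by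
    rw [div_le_iff₀ hℓpos]
    have : C / ε < ℓ := lt_of_lt_of_le hN hℓN
    rw [div_lt_iff₀ hε] at this
    linarith
  have hdiv : L ≤ R + (β₁ * ((8 * |t₁| + 16 * |t'₁|) * ℓ) + 2 * Real.log ((ℓ : ℝ) ^ 2 + 1)) / (ℓ : ℝ) ^ 2 := by
    rw [add_div' _ _ _ hℓ2.ne', le_div_iff₀ hℓ2]
    linarith
  rw [hC] at hCℓ
  linarith [hdiv, herr.trans hCℓ]

omit hU hβ in
/-- **Variational equilibrium as an equation**: with a supporting `μ₀`, the master inequality at `(β; t,t',U; μ₀, 0)` is an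
equality — `p(n) + βe_Φ(ω) = P(μ₀) + β(e_Φ(ω) − μ₀ρ(ω))`. [cite: Israel1979, Thm. I.2.4] -/
theorem IsTorusLimitOfMixture.pressureTT'_add_eq_gcPressureTT'_add_of_sectorGibbs (hn0 : 0 < n) (hn2 : n < 2)
    (h : ω.IsTorusLimitOfMixture (sectorGibbsCount n) (fun L => sectorGibbsWeightTT' β t t' U n L)
      (fun L => sectorGibbsVectorTT' t t' U n L) Ls)
    (hLs : Tendsto Ls atTop atTop) {μ₀ : ℝ} (hμ₀ : pressureTT' β t t' U n = gcPressureTT' β t t' U μ₀ - β * μ₀ * n) :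
    pressureTT' β t t' U n + β * ω.meanEnergy (hubbardTTPrimeFermionInteraction t t' U) 1 =
      gcPressureTT' β t t' U μ₀ + β * (ω.meanEnergy (hubbardTTPrimeFermionInteraction t t' U) 1 - μ₀ * ω.density) := by
  have hρ : ω.density = n := h.density_eq_of_sectorGibbs t t' U hn0.le hn2.le β hLs
  rw [hμ₀, hρ]; ring

end Canonical

end InfVolFermionState

/-! ### §4a Stationarity from (C-1) by polarisation -/

namespace InfVolFermionState

section Polarisation

variable {d : ℕ} (ω : InfVolFermionState d) {Λ Λ' : Finset (Site d)} (hΛ : Λ ⊆ Λ') (K : FermionOp Λ')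

/-- **Stationarity from (C-1) by polarisation.** If `Im ω(B̃ᴴ(KB̃ − B̃K)) = 0` for EVERY local `B ∈ 𝔄_Λ` (`B̃ = Γ_{Λ⊆Λ'}B`), then
`ω(KÃ − ÃK) = 0` for every `A ∈ 𝔄_Λ` (apply (C-1) to `1 + A` and to `1 + iA`).
[cite: ArakiMoriya2003, Theorem 12.11] [cite: BratteliRobinsonII1997, Thm. 5.3.15] -/
theorem expect_commutator_eq_zero_of_localDKMS
    (hC1 : ∀ B : FermionOp Λ, (ω.expect Λ' ((fermionEmbed (PolySite.incl hΛ) B)ᴴ *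
      (K * fermionEmbed (PolySite.incl hΛ) B - fermionEmbed (PolySite.incl hΛ) B * K))).im = 0)
    (A : FermionOp Λ) :
    ω.expect Λ' (K * fermionEmbed (PolySite.incl hΛ) A - fermionEmbed (PolySite.incl hΛ) A * K) = 0 := by
  set At := fermionEmbed (PolySite.incl hΛ) A with hAt
  set c : ℂ := ω.expect Λ' (K * At - At * K) with hc
  set Bt := fermionEmbed (PolySite.incl hΛ) ((Complex.I : ℂ) • A) with hBt
  have hBt' : Bt = (Complex.I : ℂ) • At := by rw [hBt, map_smul, hAt]
  -- (C-1) for `A`, `1 + A`, `iA`, `1 + iA`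
  have hA := hC1 A
  have h1A := hC1 (1 + A)
  have hiA := hC1 ((Complex.I : ℂ) • A)
  have h1iA := hC1 (1 + (Complex.I : ℂ) • A)
  rw [← hAt] at hA
  rw [map_add, map_one, ← hAt] at h1A
  rw [← hBt] at hiA
  rw [map_add, map_one, ← hBt] at h1iA
  -- expand `(1 + X)ᴴ (K(1+X) − (1+X)K) = (KX − XK) + Xᴴ(KX − XK)`
  have e1 : ∀ X : FermionOp Λ', (1 + X)ᴴ * (K * (1 + X) - (1 + X) * K) = (K * X - X * K) + Xᴴ * (K * X - X * K) := by
    intro X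
    rw [Matrix.conjTranspose_add, Matrix.conjTranspose_one]
    noncomm_ring
  rw [e1 At, map_add, Complex.add_im, hA, add_zero, ← hc] at h1A
  rw [e1 Bt, map_add, Complex.add_im, hiA, add_zero] at h1iA
  have hcomm : K * Bt - Bt * K = (Complex.I : ℂ) • (K * At - At * K) := by
    rw [hBt', Matrix.mul_smul, Matrix.smul_mul, smul_sub]
  rw [hcomm, map_smul, ← hc, smul_eq_mul, Complex.mul_im, Complex.I_re, Complex.I_im, zero_mul, one_mul,
    zero_add] at h1iA
  exact Complex.ext_iff.2 ⟨by simpa using h1iA, by simpa using h1A⟩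

end Polarisation

end InfVolFermionState

end Literature.MathematicalPhysics.QuantumLattice

end
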